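import Summits.NavierStokesRegularity.NavierStokesRegularity.Theorems.AxisymmetricExtremalityAxisymmetricKatoGlobalStubSeregin2020TypeIILemma22DeGiorgiTools
import Summits.NavierStokesRegularity.NavierStokesRegularity.Theorems.AxisymmetricExtremalityAxisymmetricKatoGlobalStubSeregin2020TypeIILemma22ExpansionOfPositivity
import HarnessLib

/-!
# Seregin 2020, Lemma 2.2 (after Nazarov–Uraltseva 2012), atom L3.2′ (N–U Lemma 3.2), part 1:
# the numerology and the three error terms of the energy inequality

Helper toward the stub `stub_seregin2020TypeII` of the crux `AxisymmetricKatoGlobal` (= the named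
fact `Literature.Analysis.FluidPDE.Seregin2020_axisymmetricSingularPoint_typeII`, Seregin 2020,
Thm 2.1; in the tree reduced to Lemma 2.2 = N–U 2012 Lemma 4.2 in class 𝒱, whose piece L22-C
(N–U Cor 3.3) is reduced to three analytic atoms by `lemma22_expansionOfPositivity_of_atoms`).
This file and its sibling `…Lemma22DensityPropagation` prove the atom `lemma22_densityPropagation`
(N–U Lemma 3.2, propagation of density forward in time) in the energy-class formulation. Here:

* `densityPropagation_numerology` — N–U's "`1 - δ₀ ≤ (1 - δ₀/3)³ - (8/27)δ₀²`" with the test power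
  `p = 2 + (4/27)δ₀²` (the tree's admissible powers are `p > 2`): `(1-δ₀) + e ≤ (1-δ₀/3)^p (1-δ₀/3-3σ)`
  once `e + 3σ + (2/27)δ₀² ≤ (8/27)δ₀²`;
* `densityPropagation_errorTerms` — the three right-hand terms of the energy inequality for
  `H = ((κ-τ)₊)^p` and a cut-off `ζ` (`= 1` on `B((1-σ)ρ)`, supported in `B(ρ)`, `|Dζ| ≤ C/ρ`)
  on `[t₁, t] × ℝ³`, `t - t₁ ≤ θρ²`: `4∫∫H|∇ζ|² + ∫∫H⟪U,∇ζ²⟫ + ∫∫(2/ϱ)H ∂_ϱζ² ≤ κ^p e(θ) |B(ρ)|`,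
  `e(θ) = 4C²θ + 2CKθ^{3/4} + 4CC₁θ/|B₁|` (toolbox: `lintegral_norm_drift_cylinder_le`,
  `lintegral_inv_cylRadius_cylinder_le`).

## References

* A. I. Nazarov, N. N. Uraltseva, St. Petersburg Math. J. 23 (2012) 93–115 = arXiv:1011.1888,
  Lemma 3.2 and its proof. [NazarovUraltseva2012]
* G. Seregin, Anal. Math. Phys. 10 (2020), Paper 46 = arXiv:2006.04140, Lemma 2.2. [Seregin2020]
-/

-- the problem directory repeats the summit name (D-0017); core's `dupNamespace` linter fires
set_option linter.dupNamespace false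

noncomputable section

open MeasureTheory Set Function Filter Topology TopologicalSpace Metric
open scoped NNReal ENNReal

namespace Summit.NavierStokesRegularity.NavierStokesRegularity.Theorems.AxisymmetricKatoGlobal.EulerScaling

open Literature.Analysis.FluidPDE Literature.Analysis.FluidPDE.Seregin2020
  Literature.Analysis.FluidPDE.LeiZhang2011

/-! ### L3.2′: propagation of density (N–U Lemma 3.2) -/

/-- The numerology of N–U Lemma 3.2 with the test power `p = 2 + η`, `η = (4/27)δ₀²`: for
`c = 1 - δ₀/3`, `a = c^p ≥ c²(1 - η/2)` and `c³ ≥ (1 - δ₀) + (8/27)δ₀²`, so that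
`(1 - δ₀) + e ≤ a (c - 3σ)` as soon as `e + 3σ + η/2 ≤ (8/27)δ₀²`. [cite: NazarovUraltseva2012, end of the proof of Lemma 3.2 ("Since 1-δ₀ ≤ (1-δ₀/3)³ - (8/27)δ₀²")] -/
theorem densityPropagation_numerology {δ₀ e σ : ℝ} (hδ₀ : 0 < δ₀) (hδ₀1 : δ₀ ≤ 1) (he : 0 ≤ e)
    (hσ : 0 ≤ σ) (h : e + 3 * σ + 2 / 27 * δ₀ ^ 2 ≤ 8 / 27 * δ₀ ^ 2) :
    (1 - δ₀) + e ≤ (1 - δ₀ / 3) ^ (2 + 4 / 27 * δ₀ ^ 2 : ℝ) * (1 - δ₀ / 3 - 3 * σ) := by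
  set c : ℝ := 1 - δ₀ / 3 with hc
  set η : ℝ := 4 / 27 * δ₀ ^ 2 with hη
  have hcpos : 0 < c := by rw [hc]; linarith
  have hc1 : c ≤ 1 := by rw [hc]; linarith
  have hc23 : 2 / 3 ≤ c := by rw [hc]; linarith
  have hη0 : 0 ≤ η := by positivity
  have hη1 : η ≤ 1 := by rw [hη]; nlinarith
  -- `c^η ≥ 1 - η/2`
  have hlog : -(1 / 2) ≤ Real.log c := by
    have h1 := Real.one_sub_inv_le_log_of_pos hcpos
    have h2 : c⁻¹ ≤ 3 / 2 := by rw [inv_le_comm₀ hcpos (by norm_num)]; linarith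
    linarith
  have hcη : 1 - η / 2 ≤ c ^ η := by
    rw [Real.rpow_def_of_pos hcpos]
    have := Real.add_one_le_exp (Real.log c * η)
    nlinarith
  have ha : c ^ 2 * (1 - η / 2) ≤ c ^ (2 + η) := by
    rw [Real.rpow_add hcpos, show (2 : ℝ) = ((2 : ℕ) : ℝ) by norm_num, Real.rpow_natCast]
    exact mul_le_mul_of_nonneg_left hcη (by positivity)
  have hcube : (1 - δ₀) + 8 / 27 * δ₀ ^ 2 ≤ c ^ 3 := by
    rw [hc]; nlinarith [mul_nonneg (sq_nonneg δ₀) (show 0 ≤ 1 - δ₀ by linarith)]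
  have hσc : 0 ≤ c - 3 * σ := by nlinarith
  calc (1 - δ₀) + e ≤ c ^ 3 - 3 * σ - η / 2 := by rw [hη] at *; linarith
    _ ≤ c ^ 2 * (1 - η / 2) * (c - 3 * σ) := by
        have h1 : c ^ 2 ≤ 1 := by nlinarith
        have h2 : c - 3 * σ ≤ 1 := by linarith
        nlinarith [mul_nonneg (mul_nonneg (sq_nonneg c) hη0) hσc, mul_nonneg hσ (show 0 ≤ 1 - c ^ 2 by linarith),
          mul_nonneg hη0 (show 0 ≤ 1 - c ^ 2 * (c - 3 * σ) by nlinarith)]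
    _ ≤ c ^ (2 + η) * (c - 3 * σ) := mul_le_mul_of_nonneg_right ha hσc

set_option maxHeartbeats 800000 in
-- three long integral estimates in one declaration (no search involved)
/-- **The three error terms of the energy inequality in N–U Lemma 3.2** for the test power
`H = ((κ - τ)₊)^p` and a scaled cut-off `ζ` on the slab `[t₁, t] × ℝ³` (`t - t₁ ≤ θρ²`,
`R/4 ≤ ρ ≤ 2R`): the gradient term is `≤ κ^p C²θ|B(ρ)|`, the drift term
`≤ κ^p · 2CKθ^{3/4}|B(ρ)|` (`lintegral_norm_drift_cylinder_le`, hypothesis `hK`) and the axis term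
`≤ κ^p · 4CC₁θ|B(ρ)|/|B₁|` (`lintegral_inv_cylRadius_cylinder_le`, hypothesis `hC₁`).
[cite: NazarovUraltseva2012, proof of Lemma 3.2 (estimate of the right-hand side of (3.9))] -/
theorem densityPropagation_errorTerms
    {Φ : ℝ → EuclideanSpace ℝ (Fin 3) → ℝ} {U : ℝ → EuclideanSpace ℝ (Fin 3) → EuclideanSpace ℝ (Fin 3)}
    (hUm : AEStronglyMeasurable (uncurry U) volume) (hΦ0 : ∀ t x, 0 ≤ Φ t x) {N K C₁ : ℝ≥0}
    (hK : ∀ (U : ℝ → EuclideanSpace ℝ (Fin 3) → EuclideanSpace ℝ (Fin 3)),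
      AEStronglyMeasurable (uncurry U) volume →
      ∀ (R ρ θ t₁ t₂ : ℝ), 0 < R → R / 4 ≤ ρ → ρ ≤ 2 * R → 0 < θ → -R ^ 2 ≤ t₁ → t₁ ≤ t₂ → t₂ ≤ 0 →
        t₂ - t₁ ≤ θ * ρ ^ 2 →
        (∫⁻ s in Ioo (-R ^ 2) 0, (∫⁻ y in ball (0 : EuclideanSpace ℝ (Fin 3)) (2 * R),
            ‖U s y‖ₑ ^ (3 : ℕ)) ^ (4 / 3 : ℝ) ≤ (N : ℝ≥0∞) * ENNReal.ofReal R ^ 2) →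
        ∫⁻ z in Icc t₁ t₂ ×ˢ ball (0 : EuclideanSpace ℝ (Fin 3)) ρ, ‖U z.1 z.2‖ₑ
          ≤ (K : ℝ≥0∞) * ENNReal.ofReal (θ ^ (3 / 4 : ℝ) * ρ) *
            volume (ball (0 : EuclideanSpace ℝ (Fin 3)) ρ))
    (hC₁ : ∀ (t₁ t₂ ρ : ℝ), t₁ ≤ t₂ → 0 < ρ →
      ∫⁻ z in Icc t₁ t₂ ×ˢ ball (0 : EuclideanSpace ℝ (Fin 3)) ρ, ENNReal.ofReal ((cylRadius z.2)⁻¹)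
        ≤ (C₁ : ℝ≥0∞) * ENNReal.ofReal ((t₂ - t₁) * ρ ^ 2))
    {R ρ θ t₁ t κ p Cg v : ℝ} (hR : 0 < R) (hρ : R / 4 ≤ ρ) (hρ2 : ρ ≤ 2 * R) (hρpos : 0 < ρ)
    (hθ : 0 < θ) (hbot : -R ^ 2 < t₁) (ht₁t : t₁ ≤ t) (htneg : t < 0) (htt₁ : t - t₁ ≤ θ * ρ ^ 2)
    (hκ : 0 < κ) (hp2 : 2 < p) (hCg0 : 0 ≤ Cg) (hvpos : 0 < v)
    (hVeq : volume (ball (0 : EuclideanSpace ℝ (Fin 3)) 1) = ENNReal.ofReal v)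
    (hdrift : ∫⁻ s in Ioo (-R ^ 2) 0, (∫⁻ y in ball (0 : EuclideanSpace ℝ (Fin 3)) (2 * R),
        ‖U s y‖ₑ ^ (3 : ℕ)) ^ (4 / 3 : ℝ) ≤ (N : ℝ≥0∞) * ENNReal.ofReal R ^ 2)
    {ζ : EuclideanSpace ℝ (Fin 3) → ℝ} (hζ1 : ContDiff ℝ 1 ζ) (hζ01 : ∀ x, 0 ≤ ζ x ∧ ζ x ≤ 1)
    (hζsupp : tsupport ζ ⊆ ball (0 : EuclideanSpace ℝ (Fin 3)) ρ)
    (hζgrad : ∀ x, ‖fderiv ℝ ζ x‖ ≤ Cg / ρ) :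
    4 * (∫ z in Icc t₁ t ×ˢ (univ : Set (EuclideanSpace ℝ (Fin 3))),
          max (κ - Φ z.1 z.2) 0 ^ p * ‖gradient ζ z.2‖ ^ 2) +
      (∫ z in Icc t₁ t ×ˢ (univ : Set (EuclideanSpace ℝ (Fin 3))),
          max (κ - Φ z.1 z.2) 0 ^ p * inner ℝ (U z.1 z.2) (gradient (fun y => ζ y ^ 2) z.2)) +
      (∫ z in Icc t₁ t ×ˢ (univ : Set (EuclideanSpace ℝ (Fin 3))),
          2 / cylRadius z.2 * (max (κ - Φ z.1 z.2) 0 ^ p * fderiv ℝ (fun y => ζ y ^ 2) z.2 (eR z.2)))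
    ≤ κ ^ p * ((4 * Cg ^ 2 * θ + 2 * Cg * K * θ ^ (3 / 4 : ℝ) + 4 * Cg * C₁ / v * θ) *
        (volume (ball (0 : EuclideanSpace ℝ (Fin 3)) ρ)).toReal) := by
  obtain ⟨-, -, hH0, -, -, -, hHle, -⟩ := powerTest_energyClass_props hp2 hκ.le
  -- ### notation and elementary facts
  set B : Set (EuclideanSpace ℝ (Fin 3)) := ball 0 ρ with hB
  have hvolB : volume B = ENNReal.ofReal (ρ ^ 3 * v) := by
    have e := volume_ball_mul_eq ρ 1 hρpos.le zero_le_one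
    rw [mul_one] at e
    rw [hB, e, hVeq, ← ENNReal.ofReal_mul (by positivity)]
  have hvolBtop : volume B < ∞ := by rw [hvolB]; exact ENNReal.ofReal_lt_top
  obtain ⟨mB, hmB⟩ : ∃ x : ℝ, x = (volume B).toReal := ⟨_, rfl⟩
  have hmBeq : mB = ρ ^ 3 * v := by rw [hmB, hvolB, ENNReal.toReal_ofReal (by positivity)]
  have hmBpos : 0 < mB := by rw [hmBeq]; positivity
  have hκp : 0 < κ ^ p := Real.rpow_pos_of_pos hκ p
  have hζ0 : ∀ x, x ∉ B → ζ x = 0 := fun x hx =>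
    image_eq_zero_of_notMem_tsupport fun h => hx (hζsupp h)
  have hDζ0 : ∀ x, x ∉ B → fderiv ℝ ζ x = 0 := by
    intro x hx
    have hx' : x ∉ tsupport ζ := fun h => hx (hζsupp h)
    rw [(notMem_tsupport_iff_eventuallyEq.1 hx').fderiv_eq]
    exact fderiv_const_apply 0
  have hgradζ : ∀ x, ‖gradient ζ x‖ ≤ Cg / ρ := fun x => by
    rw [gradient, LinearIsometryEquiv.norm_map]; exact hζgrad x
  have hgradζ0 : ∀ x, x ∉ B → gradient ζ x = 0 := fun x hx => by
    rw [gradient, hDζ0 x hx, map_zero]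
  -- the derivative of `ζ²`
  have hDζ2 : ∀ x, fderiv ℝ (fun y => ζ y ^ 2) x = (2 * ζ x) • fderiv ℝ ζ x := by
    intro x
    have h1 : HasFDerivAt ζ (fderiv ℝ ζ x) x := (hζ1.differentiable one_ne_zero x).hasFDerivAt
    have h2 := h1.mul h1
    have e : (fun y => ζ y ^ 2) = ζ * ζ := by funext y; simp [sq]
    rw [e, h2.fderiv, two_mul, add_smul]
  have hDζ2norm : ∀ x, ‖fderiv ℝ (fun y => ζ y ^ 2) x‖ ≤ 2 * Cg / ρ := by
    intro x
    rw [hDζ2 x, norm_smul, Real.norm_eq_abs, abs_mul, abs_of_nonneg (hζ01 x).1, abs_two]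
    have h1 := hζgrad x
    have h2 := (hζ01 x).2
    have h3 : 0 ≤ Cg / ρ := by positivity
    calc 2 * ζ x * ‖fderiv ℝ ζ x‖ ≤ 2 * 1 * (Cg / ρ) :=
          mul_le_mul (by linarith) h1 (norm_nonneg _) (by norm_num)
      _ = 2 * Cg / ρ := by ring
  have hDζ2_0 : ∀ x, x ∉ B → fderiv ℝ (fun y => ζ y ^ 2) x = 0 := fun x hx => by
    rw [hDζ2 x, hζ0 x hx, mul_zero, zero_smul]
  have hHbdd : ∀ s x, max (κ - Φ s x) 0 ^ p ≤ κ ^ p := fun s x => hHle _ (hΦ0 s x)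
  have hHnn : ∀ s x, 0 ≤ max (κ - Φ s x) 0 ^ p := fun s x => hH0 _
  -- the slab `Icc t₁ t × B` and its measure
  set W : Set (ℝ × EuclideanSpace ℝ (Fin 3)) := Icc t₁ t ×ˢ B with hW
  have hWm : MeasurableSet W := measurableSet_Icc.prod measurableSet_ball
  have hvolW : volume W = ENNReal.ofReal (t - t₁) * volume B := by
    rw [hW, Measure.volume_eq_prod, Measure.prod_prod, Real.volume_Icc]
  have hvolWtop : volume W < ∞ := by
    rw [hvolW]; exact ENNReal.mul_lt_top ENNReal.ofReal_lt_top hvolBtop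
  have hvolWreal : (volume W).toReal = (t - t₁) * mB := by
    rw [hvolW, ENNReal.toReal_mul, ENNReal.toReal_ofReal (by linarith), hmB]
  have hWsub : W ⊆ Icc t₁ t ×ˢ (univ : Set (EuclideanSpace ℝ (Fin 3))) := prod_mono Subset.rfl (subset_univ _)
  have hSm : MeasurableSet (Icc t₁ t ×ˢ (univ : Set (EuclideanSpace ℝ (Fin 3)))) :=
    measurableSet_Icc.prod MeasurableSet.univ
  -- ### (b2) the gradient term
  have hb2 : (∫ z in Icc t₁ t ×ˢ (univ : Set (EuclideanSpace ℝ (Fin 3))),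
      max (κ - Φ z.1 z.2) 0 ^ p * ‖gradient ζ z.2‖ ^ 2) ≤ κ ^ p * (Cg ^ 2 * θ * mB) := by
    have hint : Integrable (W.indicator fun _ => κ ^ p * (Cg / ρ) ^ 2)
        (volume.restrict (Icc t₁ t ×ˢ (univ : Set (EuclideanSpace ℝ (Fin 3))))) :=
      ((integrableOn_const (μ := volume) (s := W) (C := κ ^ p * (Cg / ρ) ^ 2) (hs := hvolWtop.ne)
        (hC := enorm_ne_top)).integrable_indicator hWm).restrict
    have hle : ∀ z ∈ Icc t₁ t ×ˢ (univ : Set (EuclideanSpace ℝ (Fin 3))),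
        max (κ - Φ z.1 z.2) 0 ^ p * ‖gradient ζ z.2‖ ^ 2 ≤ W.indicator (fun _ => κ ^ p * (Cg / ρ) ^ 2) z := by
      intro z hz
      by_cases hzB : z.2 ∈ B
      · rw [indicator_of_mem (show z ∈ W from ⟨hz.1, hzB⟩)]
        exact mul_le_mul (hHbdd _ _) (pow_le_pow_left₀ (norm_nonneg _) (hgradζ _) 2) (sq_nonneg _) hκp.le
      · rw [hgradζ0 _ hzB, norm_zero, zero_pow two_ne_zero, mul_zero]
        exact indicator_nonneg (fun _ _ => by positivity) _
    calc _ ≤ ∫ z in Icc t₁ t ×ˢ (univ : Set (EuclideanSpace ℝ (Fin 3))),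
          W.indicator (fun _ => κ ^ p * (Cg / ρ) ^ 2) z :=
          integral_mono_of_nonneg ((ae_restrict_mem hSm).mono fun z _ => mul_nonneg (hHnn _ _) (sq_nonneg _))
            hint ((ae_restrict_mem hSm).mono hle)
      _ = (volume W).toReal * (κ ^ p * (Cg / ρ) ^ 2) := by
          rw [integral_indicator_const _ hWm, smul_eq_mul, Measure.real, Measure.restrict_apply hWm,
            inter_eq_left.2 hWsub]
      _ ≤ κ ^ p * (Cg ^ 2 * θ * mB) := by
          rw [hvolWreal]
          have h1 : (t - t₁) * mB ≤ θ * ρ ^ 2 * mB := mul_le_mul_of_nonneg_right htt₁ hmBpos.le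
          have h2 : 0 ≤ κ ^ p * (Cg / ρ) ^ 2 := by positivity
          have e : θ * ρ ^ 2 * mB * (κ ^ p * (Cg / ρ) ^ 2) = κ ^ p * (Cg ^ 2 * θ * mB) := by
            rw [div_pow, show θ * ρ ^ 2 * mB * (κ ^ p * (Cg ^ 2 / ρ ^ 2)) =
              κ ^ p * (Cg ^ 2 / ρ ^ 2 * ρ ^ 2) * θ * mB by ring,
              div_mul_cancel₀ _ (pow_ne_zero 2 hρpos.ne')]
            ring
          calc (t - t₁) * mB * (κ ^ p * (Cg / ρ) ^ 2) ≤ θ * ρ ^ 2 * mB * (κ ^ p * (Cg / ρ) ^ 2) :=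
                mul_le_mul_of_nonneg_right h1 h2
            _ = κ ^ p * (Cg ^ 2 * θ * mB) := e
  -- ### (b3) the drift term
  have hUW : ∫⁻ z in W, ‖U z.1 z.2‖ₑ ≤ (K : ℝ≥0∞) * ENNReal.ofReal (θ ^ (3 / 4 : ℝ) * ρ) * volume B :=
    hK U hUm R ρ θ t₁ t hR hρ hρ2 hθ hbot.le ht₁t htneg.le htt₁ hdrift
  have hUWtop : ∫⁻ z in W, ‖U z.1 z.2‖ₑ < ∞ :=
    lt_of_le_of_lt hUW (ENNReal.mul_lt_top (ENNReal.mul_lt_top ENNReal.coe_lt_top ENNReal.ofReal_lt_top) hvolBtop)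
  have hUint : IntegrableOn (fun z : ℝ × EuclideanSpace ℝ (Fin 3) => ‖U z.1 z.2‖) W volume := by
    refine ⟨hUm.norm.restrict, ?_⟩
    rw [hasFiniteIntegral_iff_enorm]
    simpa only [enorm_norm] using hUWtop
  have hb3 : ‖∫ z in Icc t₁ t ×ˢ (univ : Set (EuclideanSpace ℝ (Fin 3))),
      max (κ - Φ z.1 z.2) 0 ^ p * inner ℝ (U z.1 z.2) (gradient (fun y => ζ y ^ 2) z.2)‖
        ≤ κ ^ p * (2 * Cg * K * θ ^ (3 / 4 : ℝ) * mB) := by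
    have hint : Integrable (W.indicator fun z : ℝ × EuclideanSpace ℝ (Fin 3) => κ ^ p * (2 * Cg / ρ) * ‖U z.1 z.2‖)
        (volume.restrict (Icc t₁ t ×ˢ (univ : Set (EuclideanSpace ℝ (Fin 3))))) :=
      (IntegrableOn.integrable_indicator
        (show IntegrableOn (fun z : ℝ × EuclideanSpace ℝ (Fin 3) => κ ^ p * (2 * Cg / ρ) * ‖U z.1 z.2‖) W volume
          from hUint.const_mul (κ ^ p * (2 * Cg / ρ))) hWm).restrict
    have hle : ∀ z ∈ Icc t₁ t ×ˢ (univ : Set (EuclideanSpace ℝ (Fin 3))),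
        ‖max (κ - Φ z.1 z.2) 0 ^ p * inner ℝ (U z.1 z.2) (gradient (fun y => ζ y ^ 2) z.2)‖ ≤
          W.indicator (fun z : ℝ × EuclideanSpace ℝ (Fin 3) => κ ^ p * (2 * Cg / ρ) * ‖U z.1 z.2‖) z := by
      intro z hz
      by_cases hzB : z.2 ∈ B
      · rw [indicator_of_mem (show z ∈ W from ⟨hz.1, hzB⟩), Real.norm_eq_abs, abs_mul,
          abs_of_nonneg (hHnn _ _)]
        have h1 := abs_real_inner_le_norm (U z.1 z.2) (gradient (fun y => ζ y ^ 2) z.2)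
        have h2 : ‖gradient (fun y => ζ y ^ 2) z.2‖ ≤ 2 * Cg / ρ := by
          rw [gradient, LinearIsometryEquiv.norm_map]; exact hDζ2norm _
        calc max (κ - Φ z.1 z.2) 0 ^ p * |inner ℝ (U z.1 z.2) (gradient (fun y => ζ y ^ 2) z.2)|
            ≤ κ ^ p * (‖U z.1 z.2‖ * (2 * Cg / ρ)) :=
              mul_le_mul (hHbdd _ _) (h1.trans (mul_le_mul_of_nonneg_left h2 (norm_nonneg _)))
                (abs_nonneg _) hκp.le
          _ = κ ^ p * (2 * Cg / ρ) * ‖U z.1 z.2‖ := by ring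
      · have h0 : gradient (fun y => ζ y ^ 2) z.2 = 0 := by rw [gradient, hDζ2_0 _ hzB, map_zero]
        rw [h0, inner_zero_right, mul_zero, norm_zero]
        exact indicator_nonneg (fun _ _ => by positivity) _
    calc _ ≤ ∫ z in Icc t₁ t ×ˢ (univ : Set (EuclideanSpace ℝ (Fin 3))),
          W.indicator (fun z : ℝ × EuclideanSpace ℝ (Fin 3) => κ ^ p * (2 * Cg / ρ) * ‖U z.1 z.2‖) z :=
          norm_integral_le_of_norm_le hint ((ae_restrict_mem hSm).mono hle)
      _ = κ ^ p * (2 * Cg / ρ) * (∫⁻ z in W, ‖U z.1 z.2‖ₑ).toReal := by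
          have hUm' : AEStronglyMeasurable (fun z : ℝ × EuclideanSpace ℝ (Fin 3) => U z.1 z.2)
              (volume.restrict W) := hUm.restrict
          rw [integral_indicator hWm, Measure.restrict_restrict hWm, inter_eq_left.2 hWsub,
            integral_const_mul, integral_norm_eq_lintegral_enorm hUm']
      _ ≤ κ ^ p * (2 * Cg / ρ) * ((K : ℝ) * (θ ^ (3 / 4 : ℝ) * ρ) * mB) := by
          refine mul_le_mul_of_nonneg_left ?_ (by positivity)
          have := ENNReal.toReal_mono (ENNReal.mul_lt_top (ENNReal.mul_lt_top ENNReal.coe_lt_top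
            ENNReal.ofReal_lt_top) hvolBtop).ne hUW
          rwa [ENNReal.toReal_mul, ENNReal.toReal_mul, ENNReal.coe_toReal,
            ENNReal.toReal_ofReal (by positivity), ← hmB] at this
      _ = κ ^ p * (2 * Cg * K * θ ^ (3 / 4 : ℝ) * mB) := by
          rw [show κ ^ p * (2 * Cg / ρ) * ((K : ℝ) * (θ ^ (3 / 4 : ℝ) * ρ) * mB) =
            κ ^ p * (2 * Cg / ρ * ρ) * ((K : ℝ) * θ ^ (3 / 4 : ℝ) * mB) by ring,
            div_mul_cancel₀ _ hρpos.ne']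
          ring
  -- ### (b4) the axis drift term
  have hρW : ∫⁻ z in W, ENNReal.ofReal ((cylRadius z.2)⁻¹) ≤ (C₁ : ℝ≥0∞) * ENNReal.ofReal ((t - t₁) * ρ ^ 2) :=
    hC₁ t₁ t ρ ht₁t hρpos
  have hρWtop : ∫⁻ z in W, ENNReal.ofReal ((cylRadius z.2)⁻¹) < ∞ :=
    lt_of_le_of_lt hρW (ENNReal.mul_lt_top ENNReal.coe_lt_top ENNReal.ofReal_lt_top)
  have hρm : Measurable (fun z : ℝ × EuclideanSpace ℝ (Fin 3) => (cylRadius z.2)⁻¹) :=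
    (continuous_cylRadius.measurable.comp measurable_snd).inv
  have hρint : IntegrableOn (fun z : ℝ × EuclideanSpace ℝ (Fin 3) => (cylRadius z.2)⁻¹) W volume := by
    refine ⟨hρm.aestronglyMeasurable, ?_⟩
    rw [hasFiniteIntegral_iff_enorm]
    refine lt_of_le_of_lt (le_of_eq ?_) hρWtop
    refine lintegral_congr_ae (ae_of_all _ fun z => ?_)
    dsimp only
    rw [Real.enorm_eq_ofReal (inv_nonneg.2 (cylRadius_nonneg _))]
  have hb4 : ‖∫ z in Icc t₁ t ×ˢ (univ : Set (EuclideanSpace ℝ (Fin 3))),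
      2 / cylRadius z.2 * (max (κ - Φ z.1 z.2) 0 ^ p * fderiv ℝ (fun y => ζ y ^ 2) z.2 (eR z.2))‖
        ≤ κ ^ p * (4 * Cg * C₁ / v * θ * mB) := by
    have hint : Integrable (W.indicator fun z : ℝ × EuclideanSpace ℝ (Fin 3) => κ ^ p * (4 * Cg / ρ) * (cylRadius z.2)⁻¹)
        (volume.restrict (Icc t₁ t ×ˢ (univ : Set (EuclideanSpace ℝ (Fin 3))))) :=
      (IntegrableOn.integrable_indicator
        (show IntegrableOn (fun z : ℝ × EuclideanSpace ℝ (Fin 3) => κ ^ p * (4 * Cg / ρ) * (cylRadius z.2)⁻¹) W volume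
          from hρint.const_mul (κ ^ p * (4 * Cg / ρ))) hWm).restrict
    have hle : ∀ z ∈ Icc t₁ t ×ˢ (univ : Set (EuclideanSpace ℝ (Fin 3))),
        ‖2 / cylRadius z.2 * (max (κ - Φ z.1 z.2) 0 ^ p * fderiv ℝ (fun y => ζ y ^ 2) z.2 (eR z.2))‖ ≤
          W.indicator (fun z : ℝ × EuclideanSpace ℝ (Fin 3) => κ ^ p * (4 * Cg / ρ) * (cylRadius z.2)⁻¹) z := by
      have hCρ : 0 ≤ 2 * Cg / ρ := div_nonneg (mul_nonneg zero_le_two hCg0) hρpos.le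
      intro z hz
      have hcyl : 0 ≤ cylRadius z.2 := cylRadius_nonneg z.2
      have h2 : 0 ≤ 2 / cylRadius z.2 := div_nonneg zero_le_two hcyl
      by_cases hzB : z.2 ∈ B
      · rw [indicator_of_mem (show z ∈ W from ⟨hz.1, hzB⟩)]
        have h1 : ‖fderiv ℝ (fun y => ζ y ^ 2) z.2 (eR z.2)‖ ≤ 2 * Cg / ρ := by
          calc ‖fderiv ℝ (fun y => ζ y ^ 2) z.2 (eR z.2)‖
              ≤ ‖fderiv ℝ (fun y => ζ y ^ 2) z.2‖ * ‖eR z.2‖ := ContinuousLinearMap.le_opNorm _ _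
            _ ≤ 2 * Cg / ρ * 1 := mul_le_mul (hDζ2norm _) (norm_eR_le_one _) (norm_nonneg _) hCρ
            _ = 2 * Cg / ρ := mul_one _
        have hA : ‖2 / cylRadius z.2‖ = 2 / cylRadius z.2 := Real.norm_of_nonneg h2
        have hBn : ‖max (κ - Φ z.1 z.2) 0 ^ p‖ = max (κ - Φ z.1 z.2) 0 ^ p := Real.norm_of_nonneg (hHnn _ _)
        rw [norm_mul, norm_mul, hA, hBn]
        calc 2 / cylRadius z.2 * (max (κ - Φ z.1 z.2) 0 ^ p * ‖fderiv ℝ (fun y => ζ y ^ 2) z.2 (eR z.2)‖)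
            ≤ 2 / cylRadius z.2 * (κ ^ p * (2 * Cg / ρ)) :=
              mul_le_mul_of_nonneg_left (mul_le_mul (hHbdd _ _) h1 (norm_nonneg _) hκp.le) h2
          _ = κ ^ p * (4 * Cg / ρ) * (cylRadius z.2)⁻¹ := by rw [div_eq_mul_inv 2]; ring
      · have h0 : fderiv ℝ (fun y => ζ y ^ 2) z.2 (eR z.2) = 0 := by
          simp only [hDζ2_0 _ hzB, zero_apply]
        have h00 : 2 / cylRadius z.2 * (max (κ - Φ z.1 z.2) 0 ^ p * fderiv ℝ (fun y => ζ y ^ 2) z.2 (eR z.2)) = 0 := by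
          rw [h0, mul_zero, mul_zero]
        rw [h00, norm_zero]
        have hc4 : 0 ≤ κ ^ p * (4 * Cg / ρ) :=
          mul_nonneg hκp.le (div_nonneg (mul_nonneg (by norm_num) hCg0) hρpos.le)
        exact indicator_nonneg (fun w _ => mul_nonneg hc4 (inv_nonneg.2 (cylRadius_nonneg _))) _
    have step1 : ‖∫ z in Icc t₁ t ×ˢ (univ : Set (EuclideanSpace ℝ (Fin 3))),
        2 / cylRadius z.2 * (max (κ - Φ z.1 z.2) 0 ^ p * fderiv ℝ (fun y => ζ y ^ 2) z.2 (eR z.2))‖ ≤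
        ∫ z in Icc t₁ t ×ˢ (univ : Set (EuclideanSpace ℝ (Fin 3))),
          W.indicator (fun z : ℝ × EuclideanSpace ℝ (Fin 3) => κ ^ p * (4 * Cg / ρ) * (cylRadius z.2)⁻¹) z :=
      norm_integral_le_of_norm_le hint ((ae_restrict_mem hSm).mono hle)
    have step2 : ∫ z in Icc t₁ t ×ˢ (univ : Set (EuclideanSpace ℝ (Fin 3))),
        W.indicator (fun z : ℝ × EuclideanSpace ℝ (Fin 3) => κ ^ p * (4 * Cg / ρ) * (cylRadius z.2)⁻¹) z =
        κ ^ p * (4 * Cg / ρ) * (∫⁻ z in W, ENNReal.ofReal ((cylRadius z.2)⁻¹)).toReal := by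
      rw [integral_indicator hWm, Measure.restrict_restrict hWm, inter_eq_left.2 hWsub,
        integral_const_mul, integral_eq_lintegral_of_nonneg_ae
          (ae_of_all _ fun z => inv_nonneg.2 (cylRadius_nonneg _)) hρm.aestronglyMeasurable]
    have step3 : (∫⁻ z in W, ENNReal.ofReal ((cylRadius z.2)⁻¹)).toReal ≤ (C₁ : ℝ) * ((t - t₁) * ρ ^ 2) := by
      have := ENNReal.toReal_mono (ENNReal.mul_lt_top ENNReal.coe_lt_top ENNReal.ofReal_lt_top).ne hρW
      rwa [ENNReal.toReal_mul, ENNReal.coe_toReal, ENNReal.toReal_ofReal (by nlinarith)] at this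
    have step4 : (C₁ : ℝ) * ((t - t₁) * ρ ^ 2) ≤ (C₁ : ℝ) * ((θ * ρ ^ 2) * ρ ^ 2) := by
      refine mul_le_mul_of_nonneg_left (mul_le_mul_of_nonneg_right htt₁ (sq_nonneg _)) C₁.2
    have hc4' : 0 ≤ κ ^ p * (4 * Cg / ρ) :=
      mul_nonneg hκp.le (div_nonneg (mul_nonneg (by norm_num) hCg0) hρpos.le)
    have e5 : κ ^ p * (4 * Cg / ρ) * ((C₁ : ℝ) * ((θ * ρ ^ 2) * ρ ^ 2)) = κ ^ p * (4 * Cg * C₁ / v * θ * mB) := by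
      rw [hmBeq, show κ ^ p * (4 * Cg / ρ) * ((C₁ : ℝ) * (θ * ρ ^ 2 * ρ ^ 2)) =
        κ ^ p * (4 * Cg) * (C₁ : ℝ) * θ * (ρ ^ 2 * ρ ^ 2 / ρ) by ring,
        show κ ^ p * (4 * Cg * C₁ / v * θ * (ρ ^ 3 * v)) =
          κ ^ p * (4 * Cg) * (C₁ : ℝ) * θ * (ρ ^ 3 * (v / v)) by ring,
        div_self hvpos.ne', mul_one,
        show ρ ^ 2 * ρ ^ 2 / ρ = ρ ^ 3 by
          rw [div_eq_iff hρpos.ne']; ring]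
    rw [← e5]
    exact step1.trans (step2.le.trans (mul_le_mul_of_nonneg_left (step3.trans step4) hc4'))
  -- ### the sum
  have h3 := (Real.le_norm_self _).trans hb3
  have h4 := (Real.le_norm_self _).trans hb4
  rw [← hmB]
  have esum : κ ^ p * ((4 * Cg ^ 2 * θ + 2 * Cg * K * θ ^ (3 / 4 : ℝ) + 4 * Cg * C₁ / v * θ) * mB) =
      4 * (κ ^ p * (Cg ^ 2 * θ * mB)) + κ ^ p * (2 * Cg * K * θ ^ (3 / 4 : ℝ) * mB) +
        κ ^ p * (4 * Cg * C₁ / v * θ * mB) := by ring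
  rw [esum]
  linarith [hb2, h3, h4]

end Summit.NavierStokesRegularity.NavierStokesRegularity.Theorems.AxisymmetricKatoGlobal.EulerScaling

end
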